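import Literature.IUT.HodgeArakelov.EtaleThetaDataOfSettingCuspidalGeneratorsFrame
import Literature.IUT.HodgeArakelov.EtaleThetaDataOfSettingCuspidalGeneratorsOfCommutatorAxis
import Literature.IUT.HodgeArakelov.PlusMinusTowerCoverModel
import HarnessLib

/-!
# [IUTchII] Cor. 2.5 (i), residual J1 — the GAP row's EXACT frame shape, with a bona fide cuspidal datum
# (print's Def. 2.3 (ii) family AT THE LEVEL `Π_v`), for EVERY `±`-tower over the genuine `Π_v` and at the
# genuine tower of record `PlusMinusTower.ofPiCHat`, from the commutator-axis clause alone (proof-only, 0 defs)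

S. Mochizuki, *Inter-universal Teichmüller theory II*, kurims manuscript (Dec. 2020), §2: Cor. 2.5 (i) p. 71
l. 33–37 («the inclusion `Π_{v⩒▶} ↪ Π_v` induces an isomorphism `(l·Δ_Θ)(Π_{v⩒▶}) ⥲ (l·Δ_Θ)(Π_v)`»), proof p. 72
l. 35–38 («follows immediately by considering the cuspidal inertia groups involved»); Def. 2.3 (ii) pp. 67–68
(«the cuspidal inertia groups of `Π_⊆` may be obtained as the intersections with `Π_⊆` of those cuspidal inertia
groups of `Π_⊇` that contain a finite index subgroup that lies inside `Π_⊆`»); Rmk. 2.3.1 p. 69 («`I ∩ Π_⊆ = I^l`»)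
[claim: Mochizuki2012, status: disputed] (IUTchII §2 Cor 2.5 (i), kurims p.71); S. Mochizuki, *The étale theta
function …*, Publ. RIMS **45** (2009) [EtTh], §1 p. 12, §2 p. 35 («`D_x → Π^Θ_X` … maps the inertia group `I_x ⊆ D_x`
isomorphically onto `Δ_Θ`»; «`x` the unique cusp of `X^log`») [cite: MochizukiEtTh2009, Def 2.1 p.35]; S. Mochizuki,
*Semi-graphs of anabelioids*, Publ. RIMS **42** (2006) [SemiAnbd], §6 p. 71 («`I_x := D_x ∩ Δ^temp_X`»)
[cite: MochizukiSemiAnbd2006, §6 p.71]. abc-iut cell, layer L6, node **IUTchII:Cor2.5(i)**, residual J1 = GAP-LEDGER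
**G-w4d005g4-1**; seat abc-iut-w4-d005 (gen 6; row author and zone holder), row «COR25I-TOWER-INSTANTIATION», sequel BY
NAME to abc-iut-w4-d024 (p434999, p436287) and abc-iut-w5-d165 (p435890, p436939).

WHAT IS ADDED. p436287 (`etaleThetaDataOfSetting'_hgen_frame_iff`) shows that, at the GENUINE Prop. 1.4 output
`D := etaleThetaDataOfSetting' …` and for EVERY `T : TemperedCoverings S Π_v`, `W : PlusMinusTower T`,
`Cu : CuspidalInertiaData W`, the GAP row's exact shape
`(D.lDeltaTheta.top).map ε = (D.lDeltaTheta.bot).map ε ⊔ ⨆ (I : {I // Cu.IsCuspidalInertia W.piV I}), ↑I` (`ε = W.emb ∘ T.incl`)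
is EQUIVALENT to «the `θ`-images of `Cu`'s cuspidal inertia groups of `Π_v` lie in and generate `l·Δ_Θ`»; p436939 proves
that clause for the GEOMETRIC family `{Π^tp_{X̲̲} ∩ γ I_x γ⁻¹}_γ` from the commutator-axis clause. For an ABSTRACT `Cu`
(abc-iut-L6-t1's INTERFACE, [AbsTopI] Lem. 4.5 reconstruction — FACT policy) nothing identifies `Cu`'s family with the
geometric one. HERE the identification is made where it CAN be made, i.e. for a cuspidal datum that IS print's
Def. 2.3 (ii) family at the level `Π_v` (the only level Cor. 2.5 (i) reads):

* §1 `map_phi_inf_eq_lDeltaTheta_of_isCuspidalGeometric` — for every cuspidal inertia subgroup `I` of `Π^tp_X` in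
  abc-iut-L3's vocabulary (`TemperedCurve.IsCuspidalGeometricDecompositionGroup`: a `Π^tp_X`-conjugate of `I_x`, `x` a
  cusp), `φ(I ∩ Π^tp_{X̲̲}) = l·Δ_Θ`, from the commutator-axis clause at every cusp + `Ker toTheta ≤ Π^tp_{X̲̲}` (p436939 BY
  NAME);
* §2 **`exists_cuspidalInertiaData_hgen_frame_of_commutatorAxis`** — for EVERY `±`-tower `W` over EVERY
  `T : TemperedCoverings S Π_v` (`Π_v := Π^tp_{X̲̲}` genuine) there is `Cu : CuspidalInertiaData W` whose cuspidal inertia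
  groups of `Π_v` are EXACTLY the `ε`-images of the intersections `I ∩ Π^tp_{X̲̲}` of the cuspidal inertia subgroups `I` of
  `Π^tp_X` — «the cuspidal inertia groups of `Π_⊆` [are] the intersections with `Π_⊆` of [the] cuspidal inertia groups of
  `Π_⊇`» (Def. 2.3 (ii)), «`I ∩ Π_⊆ = I^l`» (Rmk. 2.3.1) — and for THIS `Cu` the GAP row's exact shape HOLDS and Cor. 2.5
  (i)'s conclusion `((top).map ε ⊓ H) ⊔ (bot).map ε = (top).map ε` holds for every `H ⊇` those groups (the consumer's
  `Π_{v⩒▶}`, Cor. 2.4 (ii)) — all from the commutator-axis clause (+ `hker`); `…_ofCocycle_…`: at abc-iut-L2-t7's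
  constructed `X̲̲` the commutator-axis clause is the ONLY [EtTh]-level input;
* §3 `exists_cuspidalInertiaData_hgen_ofPiCHat_of_commutatorAxis` — the same AT THE GENUINE TOWER OF RECORD
  `PlusMinusTower.ofPiCHat` (abc-iut-L6-t19, B14) over the print-level setting `BadPlaceSetting.ofUnderline`;
* §4 `lDeltaTheta_eq_bot_of_hgen_frame_of_isEmpty` / `not_hgen_frame_of_isEmpty` — HONEST NEGATIVE COMPANION: for
  ANY `W`, `Cu` whose family of cuspidal inertia groups of `Π_v` is EMPTY, the GAP row's shape forces `l·Δ_Θ = 1`, i.e.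
  FAILS for non-degenerate data. Relevance: the two cuspidal data the cell has built at the genuine tower —
  abc-iut-w5-d132's TEMPERED datum of `PlusMinusTower.exists_stableCurveAgreement_ofCoverModel` (p430433; members at level
  `Π_□`: «`J ≤ Π_□ ∧ J = t · ι((g · inclX I_x · g⁻¹) ∩ inclX Π^tp_{X̲}) · t⁻¹`») and its PROFINITE datum `CuHat` of
  `PlusMinusTower.exists_cuspidalInertiaDataHat_ofCoverModel` (p432649; the `Π̂^±_v`-conjugates of the closures,
  built for LAW (a) of G-w5d243-1 at the level `Π̂^±_v`) — declare cuspidal AT EVERY LEVEL `Π_□` the (conjugates of the)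
  FULL cusp inertia groups of `X̲_v` (`≅ Ẑ(1)`, `θ`-image ALL of `Δ_Θ`) that happen to lie in `Π_□`: a CONTAINMENT filter,
  not print's INTERSECTION rule. Since `θ(Π^tp_{X̲̲}) ∩ Δ_Θ = l·Δ_Θ` (abc-iut-L2-t8's `map_toTheta_Huu`), for genuine data
  (`l ≥ 2`, `Δ_Θ ≅ Ẑ(1)`) one expects NONE of those groups inside `Π_v`, i.e. an EMPTY family at the level `Π_v`, where §4
  then says the GAP row's shape FAILS — so neither datum is the one Cor. 2.5 (i) reads at the level `Π_v` (expectation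
  recorded, NOT kernel-checked here: the interface does not record `I_x ⊆ Π^tp_{X̲}`); the datum of §2/§3 is.

HONEST LIMITS: the commutator-axis clause «`toHat(I_x) = ⟨[a,b]⟩⁻` for a topological generating pair `a, b` of `Δ_X`»
is a HYPOTHESIS — the registered ORIGIN CLAUSE G-L2t10-3 (class R, L2-side; witnessed at a root model by abc-iut-w5-d165's
p438248 `ThetaSetting.exists_isEtThOrigin_commutatorAxis_cusp`, refuted at the χ-model's synthetic cusp p433801); the
cuspidal datum of §2 speaks at the level `Π_v` only (no other level is declared cuspidal); no new `def`, no new `Prop`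
fact, no instance, zero edit of any other seat's file; nothing of [EtTh] or of the series is asserted; no side is taken
on [IUTchIII] Cor. 3.12; typed ≠ proved.
-/

noncomputable section

namespace Literature.IUT.HodgeArakelov

namespace EtaleThetaDataOfSetting

open Literature.AnabelianGeometry.EtaleTheta Literature.AnabelianGeometry.SemiGraphs
open scoped Pointwise commutatorElement

/-! ### 0. Bookkeeping: the `ConjAct` action on subgroups is conjugation by `MulAut.conj` -/

/-- `γ • H = MulAut.conj γ • H` for the `ConjAct` action on subgroups (abc-iut-L3's
`TemperedCurve.IsCuspidalGeometricDecompositionGroup` is phrased with `ConjAct`, the [EtTh] discharge files with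
`MulAut.conj`). [folklore] -/
private theorem conjAct_smul_eq_conj_smul {G : Type*} [Group G] (γ : ConjAct G) (H : Subgroup G) :
    γ • H = MulAut.conj (ConjAct.ofConjAct γ) • H := by
  ext x
  simp only [Subgroup.mem_smul_pointwise_iff_exists, ConjAct.smul_def, MulAut.smul_def, MulAut.conj_apply]

variable {p : ℕ} [Fact p.Prime] {D : Literature.AnabelianGeometry.EtaleTheta.ThetaSetting p}
  {E : D.EtaleThetaData} {l : ℕ} (C : E.DoubleUnderline l)

/-! ### 1. The clause for every cuspidal inertia subgroup of `Π^tp_X` ([SemiAnbd] §6 vocabulary) -/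

/-- **`φ(I ∩ Π^tp_{X̲̲}) = l·Δ_Θ` for every cuspidal inertia subgroup `I` of `Π^tp_X`** — `I` a `Π^tp_X`-conjugate of
`I_x = D_x ∩ Δ^tp_X` for a cusp `x` ([SemiAnbd] §6 p. 71, abc-iut-L3's `TemperedCurve.IsCuspidalGeometricDecompositionGroup`)
— from the commutator-axis clause at every cusp («`toHat(I_x) = ⟨[a,b]⟩⁻`», [EtTh] §2 p. 35 «maps `I_x` … onto `Δ_Θ`»)
and `Ker toTheta ≤ Π^tp_{X̲̲}`; abc-iut-w5-d165's `map_phi_conj_inertia_inf_eq_lDeltaTheta_of_commutatorAxis` BY NAME.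
[cite: MochizukiEtTh2009, Def 2.1 p.35] -/
theorem map_phi_inf_eq_lDeltaTheta_of_isCuspidalGeometric
    (hax : ∀ x : D.Pt, D.IsCusp x → ∃ a b : D.DeltaHat,
      (Subgroup.closure ({a, b} : Set D.DeltaHat)).topologicalClosure = ⊤ ∧
        (D.inertia x).map D.toHat.toMonoidHom =
          (Subgroup.zpowers (⁅(a : D.PiHat), (b : D.PiHat)⁆)).topologicalClosure)
    (hker : D.toTheta.ker ≤ C.Huu) {I : Subgroup D.PiTemp}
    (hI : D.IsCuspidalGeometricDecompositionGroup I) :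
    (((I ⊓ C.Huu).subgroupOf C.Huu : Subgroup (Pi C))).map (phi C) = D.lDeltaTheta l := by
  obtain ⟨x, hx, γ, rfl⟩ := hI
  obtain ⟨a, b, hdense, hIx⟩ := hax x hx
  rw [conjAct_smul_eq_conj_smul]
  exact map_phi_conj_inertia_inf_eq_lDeltaTheta_of_commutatorAxis C x hdense hIx hker _

/-! ### 2. A cuspidal datum at the level `Π_v` (print's Def. 2.3 (ii) family) for which the GAP shape HOLDS -/

/-- **IUTchII:Cor2.5(i), residual J1 — the GAP row's EXACT shape with a bona fide cuspidal datum, for EVERY `±`-tower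
over the genuine `Π_v`.** For the genuine Prop. 1.4 output `D := etaleThetaDataOfSetting' …` (`Π_v := Π^tp_{X̲̲}`), EVERY
`T : TemperedCoverings S Π_v` and EVERY `W : PlusMinusTower T` there is `Cu : CuspidalInertiaData W` such that
(1) the cuspidal inertia groups of `Π_v` for `Cu` are EXACTLY the `ε`-images (`ε = W.emb ∘ T.incl : Π_v ↪ Π̂^cor_v`) of the
intersections `I ∩ Π^tp_{X̲̲}` of the cuspidal inertia subgroups `I` of `Π^tp_X` — «the cuspidal inertia groups of `Π_⊆` [are]
the intersections with `Π_⊆` of [the] cuspidal inertia groups of `Π_⊇`» (Def. 2.3 (ii) p. 68), «`I ∩ Π_⊆ = I^l`» (Rmk. 2.3.1)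
— and no other level is declared cuspidal; (2) the GAP row's exact shape
`(D.lDeltaTheta.top).map ε = (D.lDeltaTheta.bot).map ε ⊔ ⨆ (I : {I // Cu.IsCuspidalInertia W.piV I}), ↑I` HOLDS — the
hypothesis `hgen` of abc-iut-w4-d005's `Subquotient.inf_sup_bot_eq_top_of_generators` (p431116); (3) Cor. 2.5 (i)'s
conclusion `((top).map ε ⊓ H) ⊔ (bot).map ε = (top).map ε` holds for every `H ≤ Π̂^cor_v` containing those groups (the
consumer's `Π_{v⩒▶}`, Cor. 2.4 (ii) «`I^δ_t ⊆ Π^δ_{v⩒▶}`») — «the inclusion `Π_{v⩒▶} ↪ Π_v` induces an isomorphism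
`(l·Δ_Θ)(Π_{v⩒▶}) ⥲ (l·Δ_Θ)(Π_v)`». Inputs: the commutator-axis clause at every cusp of `X` (ORIGIN CLAUSE G-L2t10-3),
`Ker toTheta ≤ Π^tp_{X̲̲}`, and one cusp `x₀` («the unique cusp of `X^log`», [EtTh] §2 p. 35).
[claim: Mochizuki2012, status: disputed] (IUTchII §2 Cor 2.5 (i), kurims p.71) -/
theorem exists_cuspidalInertiaData_hgen_frame_of_commutatorAxis (hC : D.Compat) (hS : D.Sec2Hyps)
    (hchar : PiYddCharacteristic C) {S : BadPlaceSetting.{0}} (eS : (Pi C) ≃ₜ* S.PiX) (hl : S.l = l)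
    (T : TemperedCoverings S (Pi C)) (W : PlusMinusTower T)
    (hax : ∀ x : D.Pt, D.IsCusp x → ∃ a b : D.DeltaHat,
      (Subgroup.closure ({a, b} : Set D.DeltaHat)).topologicalClosure = ⊤ ∧
        (D.inertia x).map D.toHat.toMonoidHom =
          (Subgroup.zpowers (⁅(a : D.PiHat), (b : D.PiHat)⁆)).topologicalClosure)
    (hker : D.toTheta.ker ≤ C.Huu) (x₀ : D.Pt) (hx₀ : D.IsCusp x₀) :
    ∃ Cu : CuspidalInertiaData W,
      (∀ Q' J : Subgroup W.Corhat, Cu.IsCuspidalInertia Q' J ↔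
          Q' = W.piV ∧ ∃ I : Subgroup D.PiTemp, D.IsCuspidalGeometricDecompositionGroup I ∧
            J = (((I ⊓ C.Huu).subgroupOf C.Huu : Subgroup (Pi C))).map (W.emb.comp T.incl)) ∧
      ((etaleThetaDataOfSetting' C hC hS hchar S.toThetaSetting eS hl).lDeltaTheta.top).map
            (W.emb.comp T.incl) =
          ((etaleThetaDataOfSetting' C hC hS hchar S.toThetaSetting eS hl).lDeltaTheta.bot).map
              (W.emb.comp T.incl) ⊔
            ⨆ I : {I // Cu.IsCuspidalInertia W.piV I}, (I : Subgroup W.Corhat) ∧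
      ∀ H : Subgroup W.Corhat, (∀ I, Cu.IsCuspidalInertia W.piV I → I ≤ H) →
        (((etaleThetaDataOfSetting' C hC hS hchar S.toThetaSetting eS hl).lDeltaTheta.top).map
                (W.emb.comp T.incl) ⊓ H) ⊔
            ((etaleThetaDataOfSetting' C hC hS hchar S.toThetaSetting eS hl).lDeltaTheta.bot).map
              (W.emb.comp T.incl) =
          ((etaleThetaDataOfSetting' C hC hS hchar S.toThetaSetting eS hl).lDeltaTheta.top).map
            (W.emb.comp T.incl) := by
  classical
  -- print's Def. 2.3 (ii) family at the level `Π_v`, pushed into `Π̂^cor_v` along `ε`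
  let Cu : CuspidalInertiaData W :=
    { IsCuspidalInertia := fun Q' J =>
        Q' = W.piV ∧ ∃ I : Subgroup D.PiTemp, D.IsCuspidalGeometricDecompositionGroup I ∧
          J = (((I ⊓ C.Huu).subgroupOf C.Huu : Subgroup (Pi C))).map (W.emb.comp T.incl)
      le_of_isCuspidalInertia := by
        rintro Q' J ⟨rfl, I, -, rfl⟩
        exact Subgroup.map_le_range _ _ }
  -- the clause of p436287 for this family
  have hclause :
      (∀ I : {I // Cu.IsCuspidalInertia W.piV I},
          ((I.1.comap (W.emb.comp T.incl)).map (phi C)) ≤ D.lDeltaTheta l) ∧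
        D.lDeltaTheta l ≤
          ⨆ I : {I // Cu.IsCuspidalInertia W.piV I}, (I.1.comap (W.emb.comp T.incl)).map (phi C) := by
    constructor
    · rintro ⟨J, -, I, hI, rfl⟩
      rw [Subgroup.comap_map_eq_self_of_injective W.emb_comp_incl_injective]
      exact (map_phi_inf_eq_lDeltaTheta_of_isCuspidalGeometric C hax hker hI).le
    · have hI₀ : D.IsCuspidalGeometricDecompositionGroup (D.inertia x₀) :=
        ⟨x₀, hx₀, 1, (one_smul _ _).symm⟩
      have h₀ : Cu.IsCuspidalInertia W.piV
          ((((D.inertia x₀ ⊓ C.Huu).subgroupOf C.Huu : Subgroup (Pi C))).map (W.emb.comp T.incl)) :=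
        ⟨rfl, D.inertia x₀, hI₀, rfl⟩
      calc D.lDeltaTheta l
          = (((D.inertia x₀ ⊓ C.Huu).subgroupOf C.Huu : Subgroup (Pi C))).map (phi C) :=
            (map_phi_inf_eq_lDeltaTheta_of_isCuspidalGeometric C hax hker hI₀).symm
        _ = (((((D.inertia x₀ ⊓ C.Huu).subgroupOf C.Huu : Subgroup (Pi C))).map
                (W.emb.comp T.incl)).comap (W.emb.comp T.incl)).map (phi C) := by
            rw [Subgroup.comap_map_eq_self_of_injective W.emb_comp_incl_injective]
        _ ≤ ⨆ I : {I // Cu.IsCuspidalInertia W.piV I}, (I.1.comap (W.emb.comp T.incl)).map (phi C) :=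
            le_iSup (fun I : {I // Cu.IsCuspidalInertia W.piV I} =>
              (I.1.comap (W.emb.comp T.incl)).map (phi C)) ⟨_, h₀⟩
  refine ⟨Cu, fun Q' J => Iff.rfl,
    (etaleThetaDataOfSetting'_hgen_frame_iff C T W Cu hC hS hchar eS hl).2 hclause, fun H hH => ?_⟩
  exact etaleThetaDataOfSetting'_cor25i_frame C T W Cu hC hS hchar eS hl hclause.1 hclause.2 H hH

end EtaleThetaDataOfSetting

/-! ### 2b. At the CONSTRUCTED `X̲̲`: the commutator-axis clause is the only [EtTh]-level input -/

namespace EtaleThetaDataOfSetting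

open Literature.AnabelianGeometry.EtaleTheta Literature.AnabelianGeometry.SemiGraphs
open scoped Pointwise commutatorElement

variable {p : ℕ} [Fact p.Prime] {D : Literature.AnabelianGeometry.EtaleTheta.ThetaSetting p}
  {E : D.EtaleThetaData} {l : ℕ}
  (Ξ : Literature.AnabelianGeometry.EtaleTheta.ThetaSetting.EtaleThetaData.XuuCocycleData E l)

/-- **The same at abc-iut-L2-t7's constructed `X̲̲ = Ξ.doubleUnderline`** (`Ker toTheta ≤ Π^tp_{X̲̲}` is abc-iut-w5-d165's
`XuuCocycleData.ker_toTheta_le_Huu`): for EVERY `±`-tower over the genuine `Π_v` there is a cuspidal datum at the level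
`Π_v` (print's Def. 2.3 (ii) family) for which the GAP row's exact shape and Cor. 2.5 (i)'s conclusion HOLD, the
commutator-axis clause at the cusps of `X` being the ONLY [EtTh]-level input.
[claim: Mochizuki2012, status: disputed] (IUTchII §2 Cor 2.5 (i), kurims p.71) -/
theorem exists_cuspidalInertiaData_hgen_frame_ofCocycle_of_commutatorAxis
    (hchar : PiYddCharacteristic Ξ.doubleUnderline) {S : BadPlaceSetting.{0}}
    (eS : (Pi Ξ.doubleUnderline) ≃ₜ* S.PiX) (hl : S.l = l)
    (T : TemperedCoverings S (Pi Ξ.doubleUnderline)) (W : PlusMinusTower T)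
    (hax : ∀ x : D.Pt, D.IsCusp x → ∃ a b : D.DeltaHat,
      (Subgroup.closure ({a, b} : Set D.DeltaHat)).topologicalClosure = ⊤ ∧
        (D.inertia x).map D.toHat.toMonoidHom =
          (Subgroup.zpowers (⁅(a : D.PiHat), (b : D.PiHat)⁆)).topologicalClosure)
    (x₀ : D.Pt) (hx₀ : D.IsCusp x₀) :
    ∃ Cu : CuspidalInertiaData W,
      (∀ Q' J : Subgroup W.Corhat, Cu.IsCuspidalInertia Q' J ↔
          Q' = W.piV ∧ ∃ I : Subgroup D.PiTemp, D.IsCuspidalGeometricDecompositionGroup I ∧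
            J = (((I ⊓ Ξ.doubleUnderline.Huu).subgroupOf Ξ.doubleUnderline.Huu :
              Subgroup (Pi Ξ.doubleUnderline))).map (W.emb.comp T.incl)) ∧
      ((etaleThetaDataOfSetting' Ξ.doubleUnderline Ξ.compat Ξ.sec2 hchar S.toThetaSetting eS hl).lDeltaTheta.top).map
            (W.emb.comp T.incl) =
          ((etaleThetaDataOfSetting' Ξ.doubleUnderline Ξ.compat Ξ.sec2 hchar S.toThetaSetting eS
                hl).lDeltaTheta.bot).map (W.emb.comp T.incl) ⊔
            ⨆ I : {I // Cu.IsCuspidalInertia W.piV I}, (I : Subgroup W.Corhat) ∧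
      ∀ H : Subgroup W.Corhat, (∀ I, Cu.IsCuspidalInertia W.piV I → I ≤ H) →
        (((etaleThetaDataOfSetting' Ξ.doubleUnderline Ξ.compat Ξ.sec2 hchar S.toThetaSetting eS
                  hl).lDeltaTheta.top).map (W.emb.comp T.incl) ⊓ H) ⊔
            ((etaleThetaDataOfSetting' Ξ.doubleUnderline Ξ.compat Ξ.sec2 hchar S.toThetaSetting eS
                hl).lDeltaTheta.bot).map (W.emb.comp T.incl) =
          ((etaleThetaDataOfSetting' Ξ.doubleUnderline Ξ.compat Ξ.sec2 hchar S.toThetaSetting eS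
              hl).lDeltaTheta.top).map (W.emb.comp T.incl) :=
  exists_cuspidalInertiaData_hgen_frame_of_commutatorAxis Ξ.doubleUnderline Ξ.compat Ξ.sec2 hchar eS hl T W hax
    Ξ.ker_toTheta_le_Huu x₀ hx₀

end EtaleThetaDataOfSetting

/-! ### 3. At the genuine tower of record `PlusMinusTower.ofPiCHat` (B14) -/

namespace PlusMinusTower

open Literature.AnabelianGeometry.EtaleTheta Literature.AnabelianGeometry.SemiGraphs EtaleThetaDataOfSetting
open scoped Pointwise commutatorElement

variable {p : ℕ} [Fact p.Prime] {M : MuTwoSetting p} (e : M.CLevelData)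
  {E : M.toThetaSetting.EtaleThetaData} {l : ℕ} (C : E.DoubleUnderline l) {N : ℕ+}
  (μ : M.toThetaSetting.CyclotomeMod l N) (hC : M.toThetaSetting.Compat) (hS : M.toThetaSetting.Sec2Hyps)
  (hl : l.Prime) (hp2 : p ≠ 2) (hpl : p ≠ l) (hζ : ∃ ζ : M.toThetaSetting.K, IsPrimitiveRoot ζ (4 * l))
  {η : (C.thetaEnvData μ hC hS).PiYdd → MuN p N} (hη : η ∈ (C.thetaEnvData μ hC hS).thetaCocycles)
  (hZ : Thm16Sub.KerToZIsCompactlyGenerated M.toThetaSetting) (hN : (C.Huu.subgroupOf (M.GtpXu l)).Normal)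
  (T : TemperedCoverings (BadPlaceSetting.ofUnderline C μ hC hS hl hp2 hpl hζ hη) (Pi C))

/-- **IUTchII:Cor2.5(i), residual J1, AT THE GENUINE `±`-TOWER OF RECORD** `PlusMinusTower.ofPiCHat` (abc-iut-L6-t19's B14:
`Π̂^cor_v := Π_C`, `Π^±_v := Π^tp_{X̲_v}`, over the print-level setting `BadPlaceSetting.ofUnderline`, `Π_v = Π^tp_{X̲̲}`) and
any Prop. 2.1 output `T` over `Π_v`: there is a cuspidal datum whose cuspidal inertia groups of `Π_v` are print's (the
`ε`-images of the intersections `I ∩ Π^tp_{X̲̲}` of the cuspidal inertia subgroups `I` of `Π^tp_X`), for which the GAP row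
G-w4d005g4-1's exact shape and Cor. 2.5 (i)'s conclusion HOLD — from the commutator-axis clause at the cusps of `X`
(ORIGIN CLAUSE G-L2t10-3) and `Ker toTheta ≤ Π^tp_{X̲̲}`.
[claim: Mochizuki2012, status: disputed] (IUTchII §2 Cor 2.5 (i), kurims p.71) -/
theorem exists_cuspidalInertiaData_hgen_ofPiCHat_of_commutatorAxis (hchar : PiYddCharacteristic C)
    (eS : (Pi C) ≃ₜ* (BadPlaceSetting.ofUnderline C μ hC hS hl hp2 hpl hζ hη).PiX)
    (hl' : (BadPlaceSetting.ofUnderline C μ hC hS hl hp2 hpl hζ hη).l = l)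
    (hax : ∀ x : M.toThetaSetting.Pt, M.toThetaSetting.IsCusp x → ∃ a b : M.toThetaSetting.DeltaHat,
      (Subgroup.closure ({a, b} : Set M.toThetaSetting.DeltaHat)).topologicalClosure = ⊤ ∧
        (M.toThetaSetting.inertia x).map M.toThetaSetting.toHat.toMonoidHom =
          (Subgroup.zpowers (⁅(a : M.toThetaSetting.PiHat), (b : M.toThetaSetting.PiHat)⁆)).topologicalClosure)
    (hker : M.toThetaSetting.toTheta.ker ≤ C.Huu) (x₀ : M.toThetaSetting.Pt) (hx₀ : M.toThetaSetting.IsCusp x₀) :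
    ∃ Cu : CuspidalInertiaData (ofPiCHat e C μ hC hS hl hp2 hpl hζ hη hZ hN T),
      (∀ Q' J : Subgroup (ofPiCHat e C μ hC hS hl hp2 hpl hζ hη hZ hN T).Corhat, Cu.IsCuspidalInertia Q' J ↔
          Q' = (ofPiCHat e C μ hC hS hl hp2 hpl hζ hη hZ hN T).piV ∧
            ∃ I : Subgroup M.toThetaSetting.PiTemp, M.toThetaSetting.IsCuspidalGeometricDecompositionGroup I ∧
              J = (((I ⊓ C.Huu).subgroupOf C.Huu : Subgroup (Pi C))).map
                ((ofPiCHat e C μ hC hS hl hp2 hpl hζ hη hZ hN T).emb.comp T.incl)) ∧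
      ((etaleThetaDataOfSetting' C hC hS hchar
                (BadPlaceSetting.ofUnderline C μ hC hS hl hp2 hpl hζ hη).toThetaSetting eS hl').lDeltaTheta.top).map
            ((ofPiCHat e C μ hC hS hl hp2 hpl hζ hη hZ hN T).emb.comp T.incl) =
          ((etaleThetaDataOfSetting' C hC hS hchar
                  (BadPlaceSetting.ofUnderline C μ hC hS hl hp2 hpl hζ hη).toThetaSetting eS hl').lDeltaTheta.bot).map
              ((ofPiCHat e C μ hC hS hl hp2 hpl hζ hη hZ hN T).emb.comp T.incl) ⊔
            ⨆ I : {I // Cu.IsCuspidalInertia (ofPiCHat e C μ hC hS hl hp2 hpl hζ hη hZ hN T).piV I},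
              (I : Subgroup (ofPiCHat e C μ hC hS hl hp2 hpl hζ hη hZ hN T).Corhat) ∧
      ∀ H : Subgroup (ofPiCHat e C μ hC hS hl hp2 hpl hζ hη hZ hN T).Corhat,
        (∀ I, Cu.IsCuspidalInertia (ofPiCHat e C μ hC hS hl hp2 hpl hζ hη hZ hN T).piV I → I ≤ H) →
          (((etaleThetaDataOfSetting' C hC hS hchar
                    (BadPlaceSetting.ofUnderline C μ hC hS hl hp2 hpl hζ hη).toThetaSetting eS hl').lDeltaTheta.top).map
                  ((ofPiCHat e C μ hC hS hl hp2 hpl hζ hη hZ hN T).emb.comp T.incl) ⊓ H) ⊔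
              ((etaleThetaDataOfSetting' C hC hS hchar
                    (BadPlaceSetting.ofUnderline C μ hC hS hl hp2 hpl hζ hη).toThetaSetting eS hl').lDeltaTheta.bot).map
                ((ofPiCHat e C μ hC hS hl hp2 hpl hζ hη hZ hN T).emb.comp T.incl) =
            ((etaleThetaDataOfSetting' C hC hS hchar
                  (BadPlaceSetting.ofUnderline C μ hC hS hl hp2 hpl hζ hη).toThetaSetting eS hl').lDeltaTheta.top).map
              ((ofPiCHat e C μ hC hS hl hp2 hpl hζ hη hZ hN T).emb.comp T.incl) :=
  exists_cuspidalInertiaData_hgen_frame_of_commutatorAxis C hC hS hchar eS hl' T _ hax hker x₀ hx₀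

end PlusMinusTower

/-! ### 4. Honest negative companion: an EMPTY family of cuspidal inertia groups of `Π_v` kills the shape -/

namespace EtaleThetaDataOfSetting

open Literature.AnabelianGeometry.EtaleTheta

variable {p : ℕ} [Fact p.Prime] {D : Literature.AnabelianGeometry.EtaleTheta.ThetaSetting p}
  {E : D.EtaleThetaData} {l : ℕ} (C : E.DoubleUnderline l)
  {S : BadPlaceSetting.{0}} (T : TemperedCoverings S (Pi C)) (W : PlusMinusTower T)
  (Cu : CuspidalInertiaData W)

/-- **If a cuspidal datum declares NO subgroup of `Π_v` cuspidal, the GAP row's shape forces `l·Δ_Θ = 1`.** For ANY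
`W`, `Cu` with `{I // Cu.IsCuspidalInertia W.piV I}` empty, the shape `(top).map ε = (bot).map ε ⊔ ⨆ I, ↑I` at the genuine
Prop. 1.4 output implies `l·Δ_Θ = ⊥` (by p436287's iff: `l·Δ_Θ ≤ ⨆ ∅ = ⊥`). So a datum whose family at the level `Π_v` is
empty — e.g. one that declares cuspidal at every level the FULL cusp inertia groups `≅ Ẑ(1)` lying in that level, none of
which lies in `Π_v` when `Π_v ∩ I = I^l ≠ I` (Rmk. 2.3.1) — is NOT the datum Cor. 2.5 (i) reads; the datum of §2 is.
[claim: Mochizuki2012, status: disputed] (IUTchII §2 Cor 2.5 (i), kurims p.71) -/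
theorem lDeltaTheta_eq_bot_of_hgen_frame_of_isEmpty (hC : D.Compat) (hS : D.Sec2Hyps)
    (hchar : PiYddCharacteristic C) (eS : (Pi C) ≃ₜ* S.PiX) (hl : S.l = l)
    [IsEmpty {I // Cu.IsCuspidalInertia W.piV I}]
    (h : ((etaleThetaDataOfSetting' C hC hS hchar S.toThetaSetting eS hl).lDeltaTheta.top).map (W.emb.comp T.incl) =
        ((etaleThetaDataOfSetting' C hC hS hchar S.toThetaSetting eS hl).lDeltaTheta.bot).map
            (W.emb.comp T.incl) ⊔
          ⨆ I : {I // Cu.IsCuspidalInertia W.piV I}, (I : Subgroup W.Corhat)) :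
    D.lDeltaTheta l = ⊥ := by
  have h2 := ((etaleThetaDataOfSetting'_hgen_frame_iff C T W Cu hC hS hchar eS hl).1 h).2
  rwa [iSup_of_empty, le_bot_iff] at h2

/-- Contrapositive: for non-degenerate data (`l·Δ_Θ ≠ 1` — e.g. `Δ_Θ ≅ Ẑ(1)`, `l ≠ 0`) the GAP row's shape FAILS for every
cuspidal datum whose family of cuspidal inertia groups of `Π_v` is empty.
[claim: Mochizuki2012, status: disputed] (IUTchII §2 Cor 2.5 (i), kurims p.71) -/
theorem not_hgen_frame_of_isEmpty (hC : D.Compat) (hS : D.Sec2Hyps) (hchar : PiYddCharacteristic C)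
    (eS : (Pi C) ≃ₜ* S.PiX) (hl : S.l = l) [IsEmpty {I // Cu.IsCuspidalInertia W.piV I}]
    (hne : D.lDeltaTheta l ≠ ⊥) :
    ¬ ((etaleThetaDataOfSetting' C hC hS hchar S.toThetaSetting eS hl).lDeltaTheta.top).map (W.emb.comp T.incl) =
        ((etaleThetaDataOfSetting' C hC hS hchar S.toThetaSetting eS hl).lDeltaTheta.bot).map
            (W.emb.comp T.incl) ⊔
          ⨆ I : {I // Cu.IsCuspidalInertia W.piV I}, (I : Subgroup W.Corhat) :=
  fun h => hne (lDeltaTheta_eq_bot_of_hgen_frame_of_isEmpty C T W Cu hC hS hchar eS hl h)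

end EtaleThetaDataOfSetting

end Literature.IUT.HodgeArakelov

end
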